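import Summits.QuantumFields.BalabanUV.T4Continuum.Support.NE7TorusRoadDefectClause
import Summits.QuantumFields.BalabanUV.T4Continuum.Support.NE7TorusRoadSplitClause
import HarnessLib

/-!
# NE7TorusRoadBundle — THE PER-PLAQUETTE BUNDLE OF THE v4 END FROM A LOCAL CHART (instantiation I3 of the torus road): the four clauses of F263's bundle —
# chart letters `α₀ = a₀`, `α₁ = a₁ + a₀∕M` of `A = χ•Ã`, the split (F278b), the two-region defect (F278a), the gauge matching on the plaquette's bonds (file F278c)

Cell `pub-balaban`, rung (B)+1 sub-cell t4, lineage `b2b-balaban-t4-ne7-p1` (CRUX PROVER NE7 #1 = OWNER of row NE7), generation 90; memo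
`t4/b2b-balaban-t4-ne7-p1-g90/DEFECT-FAR.md` §4 (instantiation I3 of the torus road).  Over F275 `NE7StraightDefectAssemblyV2`, F276 `NE7SmoothProductCutoff`, F277
`NE7TorusRoadGeometry`, F272 `NE7CoarseSplitAssembly`, F259 `NE7CoarseCurvatureLetterLocal.coarseCurl_le_of_agree`, `NE7TanCriticalGauge.tanCritical_gaugeAct`,
`NE7CoarseCurvatureLetter.smallField_cavgIter_gaugeAct`.

WHY (memo §4).  F263 `NE7ApeOfTorusRoadV4.hape_of_torusRoadV4` reduces `hape` to a per-plaquette bundle (chart letters, split, two-region defect on straight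
tangents, gauge matching, numeric line).  The bundle is discharged from ONE local input — a chart `(u, Ã)` of `U` around the plaquette with `U^u = e^{Ã}` on the
torus ball `|y − z|_{T(MN)} ≤ (nbRad + 2ℓ + 10)·M` and global letters `‖Ã‖ ≤ a₀`, `‖δÃ‖ ≤ a₁` (the shape of [B8] Thm 2 at `U₀ = 1` on nested cubes, (N1)-weak) —
through the cut-off representative `A = χ•Ã` (`χ` = F276's product cutoff at site scale `M`, plateau radius `ρ₁ = (nbRad + 2ℓ + 6)M`), with constants in closed form.
WHAT ([folklore] composition; 0 def, 0 sorry; dimension `d + 1`, `L ≥ 2`, `N ≥ 4ℓ + 12`).  **`exists_bundle_of_chart`**: F276's cutoff `χ` (period `MN`, width `M`,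
plateau radius `ρ₁`), its plateau∕support read through the fine torus distance, the letters of `χ•Ã`, the gauge matching (`χ = 1` and `U^u = e^{Ã}` at the plaquette),
and F278a∕F278b.  What remains for `hape` after this file: the numeric line of F263 for these closed-form constants (next file) and the chart (N1)-weak.
HONEST FRAMING (page 1): composition BY NAME of tree theorems over the chart HYPOTHESIS ((N1)-weak is NOT proved here); nothing of Bałaban's asserted; NOT (APE),
NOT ONE-STEP, NOT NE7; spine 0∕9; finite T⁴ rung (B)+1 — NOT infinite volume, NOT mass gap, NOT `BetaPertH`, NOT Clay.  Continuum YM on T⁴ ⇐ BetaPertH ∧ nine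
spine estimates (0/9 proved); BetaPertH ⇐ (D1) ∧ (D4) ∧ CAP+tail; G-an2-4 gates asym, D1 and NE2/3/4.
-/

set_option autoImplicit false

open scoped BigOperators Matrix.Norms.L2Operator
open NormedSpace Finset Set

namespace Summit.QuantumFields.BalabanUV.T4Continuum.NE7TorusRoadBundle

open Literature.MathematicalPhysics.QuantumFieldTheory.Balaban1983to89
open B7Prop1Explicit B7Prop2Explicit MatrixLog UnitaryModel
open B4ContourShift (supNorm supNorm_nonneg)
open B4TorusKernel.MultiPeriod (circAbs torusSupNorm translate torusSupNorm_translate circAbs_nonneg torusSupNorm_nonneg)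
open T4AveragingDeficitWall (IsUnitaryCfg IsSkewDir SmallField vary curlAt dirL1 flat_mem_classes)
open T4AveragingDeficitWallBoundary (IsPeriodicCfg periodBox)
open AveragingDeficitPeriodicCounting (IsPeriodicDir)
open AveragingDeficitMultiLevelPrep (LevelSmall TangentIter cavgIter)
open AveragingDeficitKDatum (isUnitaryCfg_gaugeAct)
open BlockAverageVaryHolo (nbRad)
open BlockAverageVaryDisc (rho0)
open BlockAverageCurrent (smallField_gaugeAct)
open MinimalActionLevels (perWin)
open NE3HessForm (dAction)
open BlockAveragePushDirSplit (flat)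
open NE3TangentFlatStructure (Qcoarse)
open NE3TangentCovariantTower (dirIter tangentIter_iff_dirIter_eq_zero cavgIter_flat)
open NE3LinearisedAverageSup (curvSum)
open NE3QbarIterCovLiftPrep (cruxC)
open NE3RightInverseSolveLetters (thetaLoc)
open NE3HatInvCurlLetters (curl1C curl1C_nonneg)
open NE3QuadRemainderLocality (depRad)
open NE3SmoothLiftW (isPeriodicCfg_gaugeAct)
open NE3SmoothLiftCurl (curlAt_flat_eq)
open NE3EnergyShapes (IsUnitarySite)
open B5Prop11Plancherel (Tor fine)
open B5Blocks16 (blockOf)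
open B6LowerBound2153Torus (toT rep)
open NE7CoarseCurvatureLetter (levelSmall_zero curvSum_zero smallField_cavgIter_gaugeAct)
open NE7CoarseCurvatureLetterLocal (coarseCurl_le_of_agree)
open NE7CoarseSplitAssembly (exists_coarse_split)
open NE7TanCriticalGauge (tanCritical_gaugeAct)
open NE7StraightDefectAssemblyV2 (abs_dAction_cutoffRep_le_twoRegion_straight)
open NE7SmoothProductCutoff (exists_smooth_cutoff)
open NE7TorusRoadDefectClause (defect_clause_of_chart)
open NE7TorusRoadSplitClause (split_clause_of_chart)
open NE7CentredRepresentative (supNorm_add_e_le)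
open NE7TorusRoadGeometry (depRad_succ_le tsn_fine_le_of_block_le le_tsn_block_of_le_fine tsn_fine_add_e_le le_tsn_fine_add_e tsn_fine_le_of_slab
  tsn_fine_le_of_l1_ball rep_blockOf_toT_eq tsn_fine_emod)

noncomputable section

variable {d : ℕ} {n : Type*} [Fintype n] [DecidableEq n]

/-- **THE PER-PLAQUETTE BUNDLE OF THE TORUS ROAD v4 FROM A LOCAL CHART** (statement: module docstring; `M = L^{k+1}`, `P = N·M`; the regions, the split and the
defect clause are literally those of F263 `hape_of_torusRoadV4`). [folklore] -/
theorem exists_bundle_of_chart [Nonempty n] {L : ℕ} [NeZero L] (hL : 2 ≤ L) (k : ℕ) {N ℓ : ℕ} [NeZero N] (hℓ : 1 ≤ ℓ) (hN : 4 * ℓ + 12 ≤ N)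
    -- the class radius `ε∕M²` (multi-level smallness) and the current radius `r∕M²`
    {ε r β' : ℝ} (hε : 0 ≤ ε) (hLS : LevelSmall (d + 1) L k (ε / ((L : ℝ) ^ (k + 1)) ^ 2))
    (hθ : cruxC (d + 1) L * ε < 1) (hθl : thetaLoc (d + 1) L * ε < 1) (hε1 : ε ≤ 1) (hr : 0 ≤ r) (hβ' : 0 ≤ β')
    -- the configuration: unitary, periodic, in the class, tangent-critical, with datum `D` of plaquette radius `β′`
    {U D : Site (d + 1) → Fin (d + 1) → (Matrix n n ℂ)ˣ} (hUu : IsUnitaryCfg U) (hUP : IsPeriodicCfg U ((N * L ^ (k + 1) : ℕ) : ℤ))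
    (hUε : SmallField U (ε / ((L : ℝ) ^ (k + 1)) ^ 2)) (hUr : SmallField U (r / ((L : ℝ) ^ (k + 1)) ^ 2))
    (havg : cavgIter L (k + 1) U = D) (hD : SmallField D β')
    (hcrit : ∀ φ : Site (d + 1) → Fin (d + 1) → Matrix n n ℂ, IsSkewDir φ → IsPeriodicDir φ ((N * L ^ (k + 1) : ℕ) : ℤ) → TangentIter L k U φ →
      dAction U φ (perWin (d + 1) (N * L ^ (k + 1))) = 0)
    -- the plaquette and the chart around it
    (z : Site (d + 1)) (μ ν : Fin (d + 1))
    {u : Site (d + 1) → (Matrix n n ℂ)ˣ} (hu : IsUnitarySite u) (huP : ∀ (y : Site (d + 1)) (i : Fin (d + 1)), u (y + ((N * L ^ (k + 1) : ℕ) : ℤ) • e i) = u y)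
    {At : Site (d + 1) → Fin (d + 1) → Matrix n n ℂ} (hAt : IsSkewDir At) (hAtP : IsPeriodicDir At ((N * L ^ (k + 1) : ℕ) : ℤ))
    {a₀ a₁ : ℝ} (ha₀ : 0 ≤ a₀) (ha₁ : 0 ≤ a₁) (hAtα : ∀ (y : Site (d + 1)) (κ : Fin (d + 1)), ‖At y κ‖ ≤ a₀)
    (hAt1 : ∀ (y : Site (d + 1)) (κ τ : Fin (d + 1)), ‖At (y + e τ) κ - At y κ‖ ≤ a₁)
    (hagree : ∀ (y : Site (d + 1)) (κ : Fin (d + 1)),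
      torusSupNorm (fun _ : Fin (d + 1) => L ^ (k + 1) * N) (y - z) ≤ (((nbRad (d + 1) L + 2 * ℓ + 10) * L ^ (k + 1) : ℕ) : ℝ) →
        gaugeAct u U y κ = vary (flat (d := d + 1) (n := n)) At 1 y κ)
    -- F51 ∕ F259 smallness of `M·a₀`
    (hσ : 4 * (3 + 12 * ((d + 1 : ℕ) : ℝ)) ^ 2 * (L : ℝ) ^ (k + 1) * a₀ ≤ rho0 (d + 1) L ^ 2)
    (hS1 : (8 * (3 + 12 * ((d + 1 : ℕ) : ℝ)) * (2 + 2 * ((((d + 1 : ℕ) : ℝ) + 1) * L)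
        * (1 + ((1250 * ((nbRad (d + 1) L : ℝ) + L) + 8 * (((d + 1 : ℕ) : ℝ) * L) + 2 * L) * (((d + 1 : ℕ) : ℝ) * (2 * nbRad (d + 1) L + 1) ^ (d + 1)))
          / ((L : ℝ) / (L : ℝ) ^ (d + 1))))) * ((L : ℝ) ^ (k + 1) * a₀) ≤ 1)
    (hb : 256 * (((d + 1 : ℕ) : ℝ) + 1) * L * (3 + 12 * ((d + 1 : ℕ) : ℝ)) * ((L : ℝ) ^ (k + 1) * a₀) ≤ 1) :
    ∃ (A φ₁ E : Site (d + 1) → Fin (d + 1) → Matrix n n ℂ),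
      -- (C1) the chart letters of `A = χ•Ã`
      (IsSkewDir A ∧ IsPeriodicDir A ((N * L ^ (k + 1) : ℕ) : ℤ) ∧ 0 ≤ a₀ ∧ 0 ≤ a₁ + 1 / (L : ℝ) ^ (k + 1) * a₀ ∧ (∀ y κ, ‖A y κ‖ ≤ a₀) ∧
        (∀ (y : Site (d + 1)) (κ τ' : Fin (d + 1)), ‖A (y + e τ') κ - A y κ‖ ≤ a₁ + 1 / (L : ℝ) ^ (k + 1) * a₀)) ∧
      -- (C2) the split
      (dirIter L (k + 1) (flat (d := d + 1) (n := n)) A = φ₁ + E ∧ IsPeriodicDir φ₁ (N : ℤ) ∧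
        (∀ (y : Site (d + 1)) (μ' ν' : Fin (d + 1)), ‖curlAt (flat (d := d + 1) (n := n)) φ₁ y μ' ν'‖
          ≤ (1 + 12 * ((d : ℝ) + 1)) * (β' + 28 * ((3 + 12 * ((d + 1 : ℕ) : ℝ)) * ((L : ℝ) ^ (k + 1) * a₀)
              + 4 * (3 + 12 * ((d + 1 : ℕ) : ℝ)) ^ 3 / rho0 (d + 1) L ^ 2 * ((L : ℝ) ^ (k + 1) * a₀) ^ 2) ^ 2
              + 4 * (4 * (3 + 12 * ((d + 1 : ℕ) : ℝ)) ^ 3 / rho0 (d + 1) L ^ 2 * ((L : ℝ) ^ (k + 1) * a₀) ^ 2))) ∧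
        0 ≤ (3 + 12 * ((d + 1 : ℕ) : ℝ)) * (L : ℝ) ^ (k + 1) * a₀
            + ((d : ℝ) + 1) * (4 * ((ℓ + 1 : ℕ) : ℝ) + 2) * (2 * ((3 + 12 * ((d + 1 : ℕ) : ℝ)) * (L : ℝ) ^ (k + 1) * a₀)
              + (β' + 28 * ((3 + 12 * ((d + 1 : ℕ) : ℝ)) * ((L : ℝ) ^ (k + 1) * a₀)
                + 4 * (3 + 12 * ((d + 1 : ℕ) : ℝ)) ^ 3 / rho0 (d + 1) L ^ 2 * ((L : ℝ) ^ (k + 1) * a₀) ^ 2) ^ 2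
                + 4 * (4 * (3 + 12 * ((d + 1 : ℕ) : ℝ)) ^ 3 / rho0 (d + 1) L ^ 2 * ((L : ℝ) ^ (k + 1) * a₀) ^ 2))) ∧
        (∀ (y : Tor (fun _ : Fin (d + 1) => N)) (lam : Fin (d + 1)), ‖E (rep (fun _ : Fin (d + 1) => N) y) lam‖
          ≤ (3 + 12 * ((d + 1 : ℕ) : ℝ)) * (L : ℝ) ^ (k + 1) * a₀
            + ((d : ℝ) + 1) * (4 * ((ℓ + 1 : ℕ) : ℝ) + 2) * (2 * ((3 + 12 * ((d + 1 : ℕ) : ℝ)) * (L : ℝ) ^ (k + 1) * a₀)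
              + (β' + 28 * ((3 + 12 * ((d + 1 : ℕ) : ℝ)) * ((L : ℝ) ^ (k + 1) * a₀)
                + 4 * (3 + 12 * ((d + 1 : ℕ) : ℝ)) ^ 3 / rho0 (d + 1) L ^ 2 * ((L : ℝ) ^ (k + 1) * a₀) ^ 2) ^ 2
                + 4 * (4 * (3 + 12 * ((d + 1 : ℕ) : ℝ)) ^ 3 / rho0 (d + 1) L ^ 2 * ((L : ℝ) ^ (k + 1) * a₀) ^ 2)))) ∧
        (∀ (y : Tor (fun _ : Fin (d + 1) => N)), torusSupNorm (fun _ : Fin (d + 1) => N) (rep (fun _ : Fin (d + 1) => N) y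
            - rep (fun _ : Fin (d + 1) => N) (B5Blocks16.blockOf (L ^ (k + 1)) (fun _ : Fin (d + 1) => N)
                        (toT (fine (L ^ (k + 1)) (fun _ : Fin (d + 1) => N)) z))) < ℓ →
          ∀ lam : Fin (d + 1), E (rep (fun _ : Fin (d + 1) => N) y) lam = 0)) ∧
      -- (C3) the two-region criticality defect on straight-tangent tests
      (∀ Y : Site (d + 1) → Fin (d + 1) → Matrix n n ℂ, IsSkewDir Y → IsPeriodicDir Y ((N * L ^ (k + 1) : ℕ) : ℤ) →
        (Qcoarse L)^[k + 1] Y = 0 →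
        |dAction (vary (flat (d := d + 1) (n := n)) A 1) Y (perWin (d + 1) (N * L ^ (k + 1)))|
          ≤ (r * ((L : ℝ) ^ (k + 1) * a₀) * ((curl1C (d + 1) L / (1 - thetaLoc (d + 1) L * ε))
                * (2 * (8 * (3 + 12 * ((d + 1 : ℕ) : ℝ)) * (2 + 2 * ((((d + 1 : ℕ) : ℝ) + 1) * L)
                  * (1 + ((1250 * ((nbRad (d + 1) L : ℝ) + L) + 8 * (((d + 1 : ℕ) : ℝ) * L) + 2 * L)
                      * (((d + 1 : ℕ) : ℝ) * (2 * nbRad (d + 1) L + 1) ^ (d + 1))) / ((L : ℝ) / (L : ℝ) ^ (d + 1)))))))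
              / ((L : ℝ) ^ (k + 1)) ^ 3
            + ((Fintype.card (T4AveragingDeficitWall.Plane (d + 1)) : ℝ)
              * (2 * (8 * a₀ * (2 * a₁ + 28 * a₀ ^ 2) + 6 * (Real.exp a₀ - 1) * (2 * a₁ + 24 * (Real.exp a₀ - 1) * a₀)
                  + (2 * a₁ + 24 * (Real.exp a₀ - 1) * a₀) * (2 * a₁ + 28 * a₀ ^ 2) + 960 * (Real.exp a₀ - 1) * a₀ ^ 2)
                + 64 * a₀ * a₁))
            + ((Fintype.card (T4AveragingDeficitWall.Plane (d + 1)) : ℝ)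
              * (2 * (8 * a₀ * (2 * (a₁ + 1 / (L : ℝ) ^ (k + 1) * a₀) + 28 * a₀ ^ 2)
                  + 6 * (Real.exp a₀ - 1) * (2 * (a₁ + 1 / (L : ℝ) ^ (k + 1) * a₀) + 24 * (Real.exp a₀ - 1) * a₀)
                  + (2 * (a₁ + 1 / (L : ℝ) ^ (k + 1) * a₀) + 24 * (Real.exp a₀ - 1) * a₀) * (2 * (a₁ + 1 / (L : ℝ) ^ (k + 1) * a₀) + 28 * a₀ ^ 2)
                  + 960 * (Real.exp a₀ - 1) * a₀ ^ 2)
                + 64 * a₀ * (a₁ + 1 / (L : ℝ) ^ (k + 1) * a₀))))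
            * dirL1 Y ((periodBox (d := d + 1) (N * L ^ (k + 1))).filter (fun x => ¬ (ℓ
                ≤ torusSupNorm (fun _ : Fin (d + 1) => N) ((fun i => x i / ((L ^ (k + 1) : ℕ) : ℤ))
                    - rep (fun _ : Fin (d + 1) => N) (B5Blocks16.blockOf (L ^ (k + 1)) (fun _ : Fin (d + 1) => N)
                        (toT (fine (L ^ (k + 1)) (fun _ : Fin (d + 1) => N)) z))))))
          + ((r * ((L : ℝ) ^ (k + 1) * a₀) * ((curl1C (d + 1) L / (1 - thetaLoc (d + 1) L * ε))
                * (2 * (8 * (3 + 12 * ((d + 1 : ℕ) : ℝ)) * (2 + 2 * ((((d + 1 : ℕ) : ℝ) + 1) * L)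
                  * (1 + ((1250 * ((nbRad (d + 1) L : ℝ) + L) + 8 * (((d + 1 : ℕ) : ℝ) * L) + 2 * L)
                      * (((d + 1 : ℕ) : ℝ) * (2 * nbRad (d + 1) L + 1) ^ (d + 1))) / ((L : ℝ) / (L : ℝ) ^ (d + 1)))))))
              / ((L : ℝ) ^ (k + 1)) ^ 3
            + ((Fintype.card (T4AveragingDeficitWall.Plane (d + 1)) : ℝ)
              * (2 * (8 * a₀ * (2 * a₁ + 28 * a₀ ^ 2) + 6 * (Real.exp a₀ - 1) * (2 * a₁ + 24 * (Real.exp a₀ - 1) * a₀)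
                  + (2 * a₁ + 24 * (Real.exp a₀ - 1) * a₀) * (2 * a₁ + 28 * a₀ ^ 2) + 960 * (Real.exp a₀ - 1) * a₀ ^ 2)
                + 64 * a₀ * a₁))
            + ((Fintype.card (T4AveragingDeficitWall.Plane (d + 1)) : ℝ)
              * (2 * (8 * a₀ * (2 * (a₁ + 1 / (L : ℝ) ^ (k + 1) * a₀) + 28 * a₀ ^ 2)
                  + 6 * (Real.exp a₀ - 1) * (2 * (a₁ + 1 / (L : ℝ) ^ (k + 1) * a₀) + 24 * (Real.exp a₀ - 1) * a₀)
                  + (2 * (a₁ + 1 / (L : ℝ) ^ (k + 1) * a₀) + 24 * (Real.exp a₀ - 1) * a₀) * (2 * (a₁ + 1 / (L : ℝ) ^ (k + 1) * a₀) + 28 * a₀ ^ 2)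
                  + 960 * (Real.exp a₀ - 1) * a₀ ^ 2)
                + 64 * a₀ * (a₁ + 1 / (L : ℝ) ^ (k + 1) * a₀))))
            + r * (curl1C (d + 1) L / (1 - thetaLoc (d + 1) L * ε)) / ((L : ℝ) ^ (k + 1)) ^ 3
            + 2 * (Fintype.card (T4AveragingDeficitWall.Plane (d + 1)) : ℝ)
              * (2 * (1 / (L : ℝ) ^ (k + 1)) * a₁ + 2 / ((L : ℝ) ^ (k + 1)) ^ 2 * a₀))
            * dirL1 Y ((periodBox (d := d + 1) (N * L ^ (k + 1))).filter (fun x => ℓ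
                ≤ torusSupNorm (fun _ : Fin (d + 1) => N) ((fun i => x i / ((L ^ (k + 1) : ℕ) : ℤ))
                    - rep (fun _ : Fin (d + 1) => N) (B5Blocks16.blockOf (L ^ (k + 1)) (fun _ : Fin (d + 1) => N)
                        (toT (fine (L ^ (k + 1)) (fun _ : Fin (d + 1) => N)) z)))))) ∧
      -- (C4) the gauge matching on the four bonds of the plaquette
      (IsUnitarySite u ∧ gaugeAct u U z μ = vary (flat (d := d + 1) (n := n)) A 1 z μ ∧
        gaugeAct u U (z + e μ) ν = vary (flat (d := d + 1) (n := n)) A 1 (z + e μ) ν ∧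
        gaugeAct u U (z + e ν) μ = vary (flat (d := d + 1) (n := n)) A 1 (z + e ν) μ ∧
        gaugeAct u U z ν = vary (flat (d := d + 1) (n := n)) A 1 z ν) := by
  classical
  /- §0 numerals -/
  have hL1 : 1 ≤ L := by omega
  have hM1 : 1 ≤ L ^ (k + 1) := Nat.one_le_iff_ne_zero.mpr (pow_ne_zero _ (by omega))
  have hN1 : 1 ≤ N := Nat.one_le_iff_ne_zero.mpr (NeZero.ne N)
  have hMr : ((L ^ (k + 1) : ℕ) : ℝ) = (L : ℝ) ^ (k + 1) := by push_cast; ring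
  have hMz : ((L ^ (k + 1) : ℕ) : ℤ) = (L : ℤ) ^ (k + 1) := by push_cast; ring
  have hMpos : (0 : ℝ) < (L : ℝ) ^ (k + 1) := by positivity
  have hMge1 : (1 : ℝ) ≤ (L : ℝ) ^ (k + 1) := by rw [← hMr]; exact_mod_cast hM1
  have hmc : N * L ^ (k + 1) = L ^ (k + 1) * N := Nat.mul_comm _ _
  have hP1 : 1 ≤ L ^ (k + 1) * N := Nat.one_le_iff_ne_zero.mpr (Nat.mul_ne_zero (pow_ne_zero _ (by omega)) (NeZero.ne N))
  haveI hPnz : NeZero (L ^ (k + 1) * N) := ⟨by omega⟩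
  have hnb0 : (0 : ℝ) ≤ (nbRad (d + 1) L : ℝ) := by positivity
  have hℓ1 : (1 : ℝ) ≤ ℓ := by exact_mod_cast hℓ
  -- the plateau radius `ρ₁ = (nb + 2ℓ + 6)M` (sites); the agreement radius is `ρ₁ + 4M`
  obtain ⟨ρ₁, hρ₁⟩ : ∃ ρ₁ : ℕ, ρ₁ = (nbRad (d + 1) L + 2 * ℓ + 6) * L ^ (k + 1) := ⟨_, rfl⟩
  have hρ₁r : (ρ₁ : ℝ) = ((nbRad (d + 1) L : ℝ) + 2 * ℓ + 6) * (L : ℝ) ^ (k + 1) := by rw [hρ₁]; push_cast; ring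
  have hRs : (((nbRad (d + 1) L + 2 * ℓ + 10) * L ^ (k + 1) : ℕ) : ℝ) = (ρ₁ : ℝ) + 4 * (L : ℝ) ^ (k + 1) := by
    rw [hρ₁r]; push_cast; ring
  -- the block of `z` on the coarse torus and the reduced corner `z′`
  set c : Site (d + 1) := rep (fun _ : Fin (d + 1) => N) (B5Blocks16.blockOf (L ^ (k + 1)) (fun _ : Fin (d + 1) => N)
      (toT (fine (L ^ (k + 1)) (fun _ : Fin (d + 1) => N)) z)) with hc
  have hcz : c = fun i => (z i % ((L ^ (k + 1) * N : ℕ) : ℤ)) / ((L ^ (k + 1) : ℕ) : ℤ) := by rw [hc, rep_blockOf_toT_eq]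
  obtain ⟨z', hz'⟩ : ∃ z' : Site (d + 1), z' = fun i => z i % ((L ^ (k + 1) * N : ℕ) : ℤ) := ⟨_, rfl⟩
  have hz'c : ∀ i, 0 ≤ z' i - ((L ^ (k + 1) : ℕ) : ℤ) * c i ∧ z' i - ((L ^ (k + 1) : ℕ) : ℤ) * c i ≤ ((L ^ (k + 1) : ℕ) : ℤ) - 1 := by
    intro i
    have hM0 : (0 : ℤ) < ((L ^ (k + 1) : ℕ) : ℤ) := by exact_mod_cast (by omega : 0 < L ^ (k + 1))
    have e1 : z' i - ((L ^ (k + 1) : ℕ) : ℤ) * c i = z' i % ((L ^ (k + 1) : ℕ) : ℤ) := by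
      rw [hcz, hz']
      have := Int.mul_ediv_add_emod (z i % ((L ^ (k + 1) * N : ℕ) : ℤ)) ((L ^ (k + 1) : ℕ) : ℤ)
      linarith
    rw [e1]
    exact ⟨Int.emod_nonneg _ hM0.ne', by have := Int.emod_lt_of_pos (z' i) hM0; omega⟩
  have htsnz' : ∀ x : Site (d + 1), torusSupNorm (fun _ : Fin (d + 1) => L ^ (k + 1) * N) (x - z')
      = torusSupNorm (fun _ : Fin (d + 1) => L ^ (k + 1) * N) (x - z) := fun x => by rw [hz']; exact tsn_fine_emod (L ^ (k + 1)) N x z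
  /- the cutoff `χ` (F276: period `MN`, width `M`, plateau radius `ρ₁`, centre `z`) -/

  obtain ⟨χ, hχP, hχ01, hχ1, hχ2, hχone, hχzero⟩ :=
    exists_smooth_cutoff (d := d) (P := L ^ (k + 1) * N) (m := L ^ (k + 1)) hP1 hM1 ((ρ₁ : ℤ) + ((L ^ (k + 1) : ℕ) : ℤ) - 1) z
  -- plateau and support read through the fine torus distance
  have hplat : ∀ y : Site (d + 1), torusSupNorm (fun _ : Fin (d + 1) => L ^ (k + 1) * N) (y - z) ≤ ρ₁ → χ y = 1 := by
    intro y hy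
    refine hχone y fun i => ?_
    have h1 : ((circAbs (L ^ (k + 1) * N) ((y - z) i) : ℤ) : ℝ) ≤ ρ₁ :=
      le_trans (Finset.le_sup' (fun j => ((circAbs ((fun _ : Fin (d + 1) => L ^ (k + 1) * N) j) ((y - z) j) : ℤ) : ℝ)) (Finset.mem_univ i)) hy
    have h2 : circAbs (L ^ (k + 1) * N) (y i - z i) ≤ ρ₁ := by rw [Pi.sub_apply] at h1; exact_mod_cast h1
    omega
  have hzero : ∀ y : Site (d + 1), (ρ₁ : ℝ) + 2 * (L : ℝ) ^ (k + 1) - 1 ≤ torusSupNorm (fun _ : Fin (d + 1) => L ^ (k + 1) * N) (y - z) →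
      χ y = 0 := by
    intro y hy
    obtain ⟨i, -, hi⟩ := Finset.exists_mem_eq_sup' Finset.univ_nonempty
      (fun j => ((circAbs ((fun _ : Fin (d + 1) => L ^ (k + 1) * N) j) ((y - z) j) : ℤ) : ℝ))
    refine hχzero y ⟨i, ?_⟩
    have h1 : (ρ₁ : ℝ) + 2 * (L : ℝ) ^ (k + 1) - 1 ≤ ((circAbs (L ^ (k + 1) * N) ((y - z) i) : ℤ) : ℝ) := by
      unfold torusSupNorm at hy; rw [hi] at hy; exact hy
    rw [← hMr] at h1
    have h2 : (ρ₁ : ℤ) + 2 * ((L ^ (k + 1) : ℕ) : ℤ) - 1 ≤ circAbs (L ^ (k + 1) * N) (y i - z i) := by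
      rw [Pi.sub_apply] at h1; exact_mod_cast h1
    omega

  set U' : Site (d + 1) → Fin (d + 1) → (Matrix n n ℂ)ˣ := gaugeAct u U with hU'
  /- §3 the cut-off representative `A = χ•Ã` and its letters -/
  set A : Site (d + 1) → Fin (d + 1) → Matrix n n ℂ := fun y κ => χ y • At y κ with hA
  have hAs : IsSkewDir A := fun y κ => skewAdjoint.smul_mem (χ y) (hAt y κ)
  have hAtP' : IsPeriodicDir At ((L ^ (k + 1) * N : ℕ) : ℤ) := by rw [← hmc]; exact hAtP
  have hAP' : IsPeriodicDir A ((L ^ (k + 1) * N : ℕ) : ℤ) := fun y i κ => by simp only [hA, hχP y i, hAtP' y i κ]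
  have hAP : IsPeriodicDir A ((N * L ^ (k + 1) : ℕ) : ℤ) := by rw [hmc]; exact hAP'
  have hχabs : ∀ y, |χ y| ≤ 1 := fun y => abs_le.mpr ⟨by linarith [(hχ01 y).1], (hχ01 y).2⟩
  have hAα : ∀ (y : Site (d + 1)) (κ : Fin (d + 1)), ‖A y κ‖ ≤ a₀ := by
    intro y κ
    show ‖χ y • At y κ‖ ≤ a₀
    rw [norm_smul, Real.norm_eq_abs]
    calc |χ y| * ‖At y κ‖ ≤ 1 * a₀ := mul_le_mul (hχabs y) (hAtα y κ) (norm_nonneg _) zero_le_one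
      _ = a₀ := one_mul _
  have hc1 : ∀ (y : Site (d + 1)) (κ : Fin (d + 1)), |χ (y + e κ) - χ y| ≤ 1 / (L : ℝ) ^ (k + 1) := by
    intro y κ; have := hχ1 y κ; rwa [hMr] at this
  have hc2 : ∀ (y : Site (d + 1)) (κ τ : Fin (d + 1)), |(χ (y + e κ) - χ y) - (χ (y - e τ + e κ) - χ (y - e τ))| ≤ 2 / ((L : ℝ) ^ (k + 1)) ^ 2 := by
    intro y κ τ; have := hχ2 y κ τ; rwa [hMr] at this
  have hc₁0 : (0 : ℝ) ≤ 1 / (L : ℝ) ^ (k + 1) := by positivity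
  have hc₂0 : (0 : ℝ) ≤ 2 / ((L : ℝ) ^ (k + 1)) ^ 2 := by positivity
  have hα₁' : 0 ≤ a₁ + 1 / (L : ℝ) ^ (k + 1) * a₀ := by positivity
  have hA1 : ∀ (y : Site (d + 1)) (κ τ : Fin (d + 1)), ‖A (y + e τ) κ - A y κ‖ ≤ a₁ + 1 / (L : ℝ) ^ (k + 1) * a₀ := by
    intro y κ τ
    show ‖χ (y + e τ) • At (y + e τ) κ - χ y • At y κ‖ ≤ _
    have e1 : χ (y + e τ) • At (y + e τ) κ - χ y • At y κ = χ (y + e τ) • (At (y + e τ) κ - At y κ) + (χ (y + e τ) - χ y) • At y κ := by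
      simp only [smul_sub, sub_smul]; abel
    rw [e1]
    refine (norm_add_le _ _).trans (add_le_add ?_ ?_)
    · rw [norm_smul, Real.norm_eq_abs]
      calc |χ (y + e τ)| * ‖At (y + e τ) κ - At y κ‖ ≤ 1 * a₁ := mul_le_mul (hχabs _) (hAt1 y κ τ) (norm_nonneg _) zero_le_one
        _ = a₁ := one_mul _
    · rw [norm_smul, Real.norm_eq_abs]
      exact mul_le_mul (hc1 y τ) (hAtα y κ) (norm_nonneg _) hc₁0
  -- where `χ = 1`, `e^{A} = e^{Ã}`
  have hvaryA : ∀ (y : Site (d + 1)) (κ : Fin (d + 1)), χ y = 1 →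
      vary (flat (d := d + 1) (n := n)) A 1 y κ = vary (flat (d := d + 1) (n := n)) At 1 y κ := by
    intro y κ hy
    show (flat (d := d + 1) (n := n)) y κ * expUnit (((1 : ℝ) : ℂ) • (χ y • At y κ))
      = (flat (d := d + 1) (n := n)) y κ * expUnit (((1 : ℝ) : ℂ) • At y κ)
    rw [hy, one_smul]
  -- agreement: `U′ = e^{Ã}` on the chart ball, `e^{A} = U′` on the plateau
  have hagreeAt : ∀ (y : Site (d + 1)) (κ : Fin (d + 1)),
      torusSupNorm (fun _ : Fin (d + 1) => L ^ (k + 1) * N) (y - z) ≤ (ρ₁ : ℝ) + 4 * (L : ℝ) ^ (k + 1) →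
      U' y κ = vary (flat (d := d + 1) (n := n)) At 1 y κ := by
    intro y κ hy
    exact hagree y κ (by rw [hRs]; exact hy)
  have hagreeA : ∀ (y : Site (d + 1)) (κ : Fin (d + 1)), torusSupNorm (fun _ : Fin (d + 1) => L ^ (k + 1) * N) (y - z) ≤ ρ₁ →
      vary (flat (d := d + 1) (n := n)) A 1 y κ = U' y κ := by
    intro y κ hy
    rw [hvaryA y κ (hplat y hy), hagreeAt y κ (by linarith [hMpos.le])]
  have hRs' := hRs
  /- (C4) the gauge matching on the plaquette's bonds -/
  have htsn0 : torusSupNorm (fun _ : Fin (d + 1) => L ^ (k + 1) * N) (z - z) = 0 := by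
    rw [sub_self]
    unfold torusSupNorm
    refine le_antisymm (Finset.sup'_le _ _ fun i _ => ?_) ?_
    · simp [B4TorusKernel.MultiPeriod.circAbs]
    · obtain ⟨i, -, hi⟩ := Finset.exists_mem_eq_sup' Finset.univ_nonempty
        (fun j => ((circAbs ((fun _ : Fin (d + 1) => L ^ (k + 1) * N) j) ((0 : Site (d + 1)) j) : ℤ) : ℝ))
      rw [hi]; exact_mod_cast circAbs_nonneg hP1 _
  have hρ₁ge : (2 : ℝ) ≤ ρ₁ := by
    have h2 : 2 ≤ ρ₁ := by
      rw [hρ₁]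
      calc 2 ≤ nbRad (d + 1) L + 2 * ℓ + 6 := by omega
        _ ≤ (nbRad (d + 1) L + 2 * ℓ + 6) * L ^ (k + 1) := Nat.le_mul_of_pos_right _ (by omega)
    exact_mod_cast h2
  have hz0 : torusSupNorm (fun _ : Fin (d + 1) => L ^ (k + 1) * N) (z - z) ≤ ρ₁ := by rw [htsn0]; linarith
  have hzμ : torusSupNorm (fun _ : Fin (d + 1) => L ^ (k + 1) * N) (z + e μ - z) ≤ ρ₁ := by
    have := tsn_fine_add_e_le (L ^ (k + 1) * N) z z μ; rw [htsn0] at this; linarith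
  have hzν : torusSupNorm (fun _ : Fin (d + 1) => L ^ (k + 1) * N) (z + e ν - z) ≤ ρ₁ := by
    have := tsn_fine_add_e_le (L ^ (k + 1) * N) z z ν; rw [htsn0] at this; linarith
  have hC4 : IsUnitarySite u ∧ gaugeAct u U z μ = vary (flat (d := d + 1) (n := n)) A 1 z μ ∧
      gaugeAct u U (z + e μ) ν = vary (flat (d := d + 1) (n := n)) A 1 (z + e μ) ν ∧
      gaugeAct u U (z + e ν) μ = vary (flat (d := d + 1) (n := n)) A 1 (z + e ν) μ ∧
      gaugeAct u U z ν = vary (flat (d := d + 1) (n := n)) A 1 z ν :=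
    ⟨hu, (hagreeA z μ hz0).symm, (hagreeA (z + e μ) ν hzμ).symm, (hagreeA (z + e ν) μ hzν).symm, (hagreeA z ν hz0).symm⟩
  /- (C3) and (C2) from the two clauses above -/
  have hC3 := defect_clause_of_chart (n := n) hL k hℓ hε hLS hθ hθl hε1 hr hUu hUP hUε hUr hcrit z hu huP hAt hAtP ha₀ ha₁ hAtα hAt1
    hagree hσ hS1 hb χ hχP hχ01 hc1 hc2 hρ₁ hplat hzero
  obtain ⟨φ₁, E, hC2⟩ := split_clause_of_chart (n := n) hL k hℓ hN hε hLS hθ hθl hε1 hr hβ' hUu hUP hUε hUr havg hD hcrit z hu huP hAt hAtP ha₀ ha₁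
    hAtα hAt1 hagree hσ χ hχP hχ01 hc1 hρ₁ hplat
  exact ⟨A, φ₁, E, ⟨hAs, hAP, ha₀, hα₁', hAα, hA1⟩, hC2, hC3, hC4⟩

end

end Summit.QuantumFields.BalabanUV.T4Continuum.NE7TorusRoadBundle
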